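import Summits.BirchSwinnertonDyer.BirchSwinnertonDyer.Theorems.KimAtThreeFineKatoKPortGoodSubgroup
import Literature.NumberTheory.GaloisRepresentations.NormIntegerAdicComplete
import Mathlib.NumberTheory.Padics.ProperSpace
import Mathlib.Topology.Algebra.Valued.LocallyCompact
import HarnessLib

/-!
# K-PORT glue (toward `hres`): the valuation ring `𝒪_K` of a FINITE extension `K ⊇ ℚ_p` in the
# `unitBall` currency — henselian, finite residue field of characteristic `p`, Frobenius onto,
# residues versus norms, Galois automorphisms on `𝒪_K`
# (cell `bsd-addord`, seat w2-kport gen 2; `--supports stmt-BirchSwinnertonDyer-19560`, helper)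

HONEST FRAMING. Route W2 (`route-BirchSwinnertonDyer-KimAtThreeKolyvagin`), crux 19560
`KatoKuriharaPortThreeShared`, residual ⟨C1⟩ clause (C1.c) = SAT₀'s E-side over `K_w`. Gen 0 of this
seat assembled kim3's CONSUMER THEOREM (`KPort.consumer_of_exists_norm_not_mem_kernel`, file
`…KPortConsumer`) MODULO the residue-field input `hres : ∃ P ∈ E₀(K), N(P) = ∑_σ σP ∉ E₁(K)`. The proof
of `hres` (this gen, files `…KPortResidueField` (this file), `…KPortInertia`, `…KPortUnitTrace`,
`…KPortCuspChart`, `…KPortConsumerHolds`) needs four classical facts about the valuation ring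
`𝒪_K = unitBall K` of a finite extension `K/ℚ_p` typed, as everywhere in the port, as an abstract
`[NontriviallyNormedField K] [NormedAlgebra ℚ_[p] K] [IsUltrametricDist K] [FiniteDimensional ℚ_[p] K]`:
(r4) `𝒪_K` is HENSELIAN (so the tree's `reductionHom_surjective` applies), its residue field `k` is
FINITE of characteristic `p` (so Frobenius is onto — the input of the inertia argument of
`…KPortInertia`), residues are read off from norms, and `Gal(K/ℚ_p)` preserves `𝒪_K`. All four are
ASSEMBLED here from Mathlib (`FiniteDimensional.proper`, `Padic.instProperSpace`,
`Valued.integer.compactSpace_iff_completeSpace_and_isDiscreteValuationRing_and_finite_residueField`,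
`frobenius_inj`) and the tree (`Ultrametric.henselianLocalRing_integer`, `Ultrametric.compactSpace_integer`
of `NormIntegerAdicComplete` / `NormUniformizer`, whose `Valued.integer K` for the norm-induced valuation IS
`unitBall K` definitionally). TOOL theorems only (no definition, no named fact, no `sorry`); closes
nothing by itself; nothing booked.

## What is proved (`𝒪 = unitBall K`, `k = IsLocalRing.ResidueField 𝒪`)

* §1 (`K/ℚ_p` finite): `properSpace_of_finiteDimensional`, **`henselianLocalRing_unitBall`**,
  `henselianRing_unitBall`, **`finite_residueField_unitBall`**, `charP_residueField_unitBall` (any `K`),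
  `pow_prime_surjective_residueField` (Frobenius onto `k`), `exists_norm_pow_prime_sub_lt_one`
  (every `u ∈ 𝒪` is a `p`-th power mod `𝔪`).
* §2 residues vs norms: `residue_mk_eq_zero_iff_norm_lt_one`, `residue_mk_eq_residue_mk_iff`,
  `norm_eq_one_of_residue_ne_zero`.
* §3 Galois on `𝒪`: `norm_galois_le_one`, `norm_galois_sub_lt_one_iff` (`σ̄ ū = ū ↔ ‖σu − u‖ < 1`),
  `norm_mul_galois_sub_lt_one` (the inertia condition is multiplicative), `norm_pow_galois_sub_lt_one`,
  `norm_inv_galois_sub_lt_one`; unramified `K` (`hK : ‖x‖ < 1 → ‖x‖ ≤ ‖p‖`):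
  `exists_eq_prime_mul_of_norm_lt_one` (`𝔪 = p𝒪`).

References: J.-P. Serre, *Local Fields* (1979), Ch. I §1, Ch. II §1–§4 [SerreLocalFields1979];
J. W. S. Cassels, *Local Fields* (1986), Ch. 4 Lemma 3.1, Ch. 7 [Cassels1986]; kim3 brief
HOME/kim3/KIM3-KPORT-BRIEF-g12.md §3 (P3).
-/

noncomputable section

-- the cell's Theorems namespace `Summit.BirchSwinnertonDyer.BirchSwinnertonDyer.…` repeats the summit name by design (D-0017)
set_option linter.dupNamespace false

open scoped Classical NNReal

namespace Summit.BirchSwinnertonDyer.BirchSwinnertonDyer.Theorems.KPort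

open Summit.BirchSwinnertonDyer.Rank1Residual.Additive.BallEval
open Literature.NumberTheory.GaloisRepresentations.LubinTate (unitBall mem_unitBall_iff)

/-! ## §1 `K/ℚ_p` finite: `𝒪_K` henselian, `k` finite of characteristic `p`, Frobenius onto -/

section Finite

variable (p : ℕ) [hp : Fact p.Prime] (K : Type*) [NontriviallyNormedField K] [NormedAlgebra ℚ_[p] K]
  [IsUltrametricDist K] [FiniteDimensional ℚ_[p] K]
include p

omit [IsUltrametricDist K] in
/-- A finite extension `K` of `ℚ_p` is a proper (locally compact) metric space. [cite: SerreLocalFields1979, Ch. II §1] -/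
theorem properSpace_of_finiteDimensional : ProperSpace K := FiniteDimensional.proper ℚ_[p] K

open scoped NormedField in
/-- **`𝒪_K` is henselian** for `K/ℚ_p` finite (Hensel's lemma; tree `Ultrametric.henselianLocalRing_integer`,
whose `Valued.integer K` for the norm-induced valuation is `unitBall K` by `rfl`). [cite: Cassels1986, Ch. 4 Lemma 3.1] -/
theorem henselianLocalRing_unitBall : HenselianLocalRing (unitBall K) := by
  haveI : ProperSpace K := properSpace_of_finiteDimensional p K
  exact Literature.NumberTheory.GaloisRepresentations.Ultrametric.henselianLocalRing_integer (F := K)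

/-- `𝒪_K` is henselian at its maximal ideal (the hypothesis of the tree's `reductionHom_surjective`).
[cite: Cassels1986, Ch. 4 Lemma 3.1] -/
theorem henselianRing_unitBall : HenselianRing (unitBall K) (IsLocalRing.maximalIdeal (unitBall K)) := by
  haveI := henselianLocalRing_unitBall p K
  infer_instance

open scoped NormedField Valued in
/-- **The residue field `k = 𝒪_K/𝔪_K` of a finite extension `K/ℚ_p` is finite** (`𝒪_K` is compact).
[cite: SerreLocalFields1979, Ch. II §1] -/
theorem finite_residueField_unitBall : Finite (IsLocalRing.ResidueField (unitBall K)) := by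
  haveI : ProperSpace K := properSpace_of_finiteDimensional p K
  haveI hc : CompactSpace (Valued.integer K) :=
    Literature.NumberTheory.GaloisRepresentations.Ultrametric.compactSpace_integer
  haveI : (Valued.v : Valuation K ℝ≥0).RankOne := (inferInstance : (NormedField.valuation (K := K)).RankOne)
  exact ((Valued.integer.compactSpace_iff_completeSpace_and_isDiscreteValuationRing_and_finite_residueField
    (K := K)).mp hc).2.2

omit [FiniteDimensional ℚ_[p] K] in
/-- `k` has characteristic `p` (`‖p‖ < 1`). [cite: SerreLocalFields1979, Ch. II §4] -/
theorem charP_residueField_unitBall : CharP (IsLocalRing.ResidueField (unitBall K)) p :=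
  (CharP.charP_iff_prime_eq_zero hp.out).mpr (natCast_prime_residueField_eq_zero (p := p) (K := K))

/-- **Frobenius is onto `k`** (`k` finite of characteristic `p`). [cite: SerreLocalFields1979, Ch. II §4] -/
theorem pow_prime_surjective_residueField :
    Function.Surjective (fun x : IsLocalRing.ResidueField (unitBall K) => x ^ p) := by
  haveI := finite_residueField_unitBall p K
  haveI := charP_residueField_unitBall p K
  exact Finite.surjective_of_injective (frobenius_inj (IsLocalRing.ResidueField (unitBall K)) p)

/-- Every `u ∈ 𝒪_K` is a `p`-th power modulo `𝔪_K`: some `w ∈ 𝒪_K` has `‖w ^ p − u‖ < 1`.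
[cite: SerreLocalFields1979, Ch. II §4] -/
theorem exists_norm_pow_prime_sub_lt_one {u : K} (hu : ‖u‖ ≤ 1) :
    ∃ w : K, ‖w‖ ≤ 1 ∧ ‖w ^ p - u‖ < 1 := by
  obtain ⟨ω, hω⟩ := pow_prime_surjective_residueField p K
    (IsLocalRing.residue (unitBall K) ⟨u, (mem_unitBall_iff K).mpr hu⟩)
  obtain ⟨w, rfl⟩ := IsLocalRing.residue_surjective ω
  refine ⟨w, (mem_unitBall_iff K).mp w.2, ?_⟩
  have h : IsLocalRing.residue (unitBall K) (w ^ p - ⟨u, (mem_unitBall_iff K).mpr hu⟩) = 0 := by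
    rw [map_sub, map_pow, sub_eq_zero]; exact hω
  rw [IsLocalRing.residue_eq_zero_iff, IsLocalRing.mem_maximalIdeal, mem_nonunits_iff] at h
  have hv := Valuation.integer.integers (NormedField.valuation (K := K))
  have hne : NormedField.valuation (K := K) (((w ^ p - ⟨u, (mem_unitBall_iff K).mpr hu⟩ : unitBall K) : K)) ≠ 1 :=
    fun h1 => h (hv.isUnit_of_one' h1)
  have hle : ‖(((w ^ p - ⟨u, (mem_unitBall_iff K).mpr hu⟩ : unitBall K)) : K)‖ ≤ 1 :=
    (mem_unitBall_iff K).mp (w ^ p - ⟨u, _⟩).2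
  have hne' : ‖(((w ^ p - ⟨u, (mem_unitBall_iff K).mpr hu⟩ : unitBall K)) : K)‖ ≠ 1 := by
    intro h1; apply hne
    rw [← NNReal.coe_inj, NormedField.valuation_apply, coe_nnnorm, NNReal.coe_one]; exact h1
  exact lt_of_le_of_ne hle hne'

end Finite

/-! ## §2 Residues versus norms -/

section Residue

variable {K : Type*} [NontriviallyNormedField K] [IsUltrametricDist K]

/-- `ā = 0 ↔ ‖a‖ < 1` for `a ∈ 𝒪_K`. [cite: SerreLocalFields1979, Ch. I §1] -/
theorem residue_mk_eq_zero_iff_norm_lt_one {a : K} (ha : ‖a‖ ≤ 1) :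
    IsLocalRing.residue (unitBall K) ⟨a, (mem_unitBall_iff K).mpr ha⟩ = 0 ↔ ‖a‖ < 1 := by
  refine ⟨fun h => ?_, fun h => residue_eq_zero_of_norm_lt_one h⟩
  rw [IsLocalRing.residue_eq_zero_iff, IsLocalRing.mem_maximalIdeal, mem_nonunits_iff] at h
  have hv := Valuation.integer.integers (NormedField.valuation (K := K))
  refine lt_of_le_of_ne ha fun h1 => h (hv.isUnit_of_one' ?_)
  rw [← NNReal.coe_inj, NormedField.valuation_apply, coe_nnnorm, NNReal.coe_one]; exact h1

/-- The residue of any element of `𝒪_K` vanishes iff its norm is `< 1`. [cite: SerreLocalFields1979, Ch. I §1] -/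
theorem residue_eq_zero_iff_norm_lt_one (a : unitBall K) :
    IsLocalRing.residue (unitBall K) a = 0 ↔ ‖(a : K)‖ < 1 :=
  residue_mk_eq_zero_iff_norm_lt_one ((mem_unitBall_iff K).mp a.2)

/-- `ā = b̄ ↔ ‖a − b‖ < 1` on `𝒪_K`. [cite: SerreLocalFields1979, Ch. I §1] -/
theorem residue_eq_residue_iff_norm_sub_lt_one (a b : unitBall K) :
    IsLocalRing.residue (unitBall K) a = IsLocalRing.residue (unitBall K) b ↔ ‖(a : K) - b‖ < 1 := by
  rw [← sub_eq_zero, ← map_sub, residue_eq_zero_iff_norm_lt_one]; rfl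

/-- An element of `𝒪_K` with non-zero residue has norm `1`. [cite: SerreLocalFields1979, Ch. I §1] -/
theorem norm_eq_one_of_residue_ne_zero {a : unitBall K} (h : IsLocalRing.residue (unitBall K) a ≠ 0) :
    ‖(a : K)‖ = 1 := by
  have hle := (mem_unitBall_iff K).mp a.2
  rcases hle.lt_or_eq with hlt | heq
  · exact (h ((residue_eq_zero_iff_norm_lt_one a).mpr hlt)).elim
  · exact heq

/-- `‖∑ᵢ aᵢ‖ = 1 ↔ ∑ᵢ āᵢ ≠ 0` for a finite family in `𝒪_K`. [cite: SerreLocalFields1979, Ch. I §1] -/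
theorem norm_sum_eq_one_iff_residue_sum_ne_zero {ι : Type*} (s : Finset ι) (a : ι → unitBall K) :
    ‖∑ i ∈ s, (a i : K)‖ = 1 ↔ ∑ i ∈ s, IsLocalRing.residue (unitBall K) (a i) ≠ 0 := by
  rw [← map_sum, Ne, residue_eq_zero_iff_norm_lt_one, not_lt]
  have hle : ‖((∑ i ∈ s, a i : unitBall K) : K)‖ ≤ 1 := (mem_unitBall_iff K).mp (∑ i ∈ s, a i).2
  rw [show ((∑ i ∈ s, a i : unitBall K) : K) = ∑ i ∈ s, (a i : K) from by push_cast; rfl] at hle ⊢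
  exact ⟨fun h => h.ge, fun h => le_antisymm hle h⟩

end Residue

/-! ## §3 Galois automorphisms on `𝒪_K`; the inertia condition; `𝔪 = p𝒪` for unramified `K` -/

section Galois

variable {p : ℕ} [hp : Fact p.Prime] {K : Type*} [NontriviallyNormedField K] [NormedAlgebra ℚ_[p] K]
  [IsUltrametricDist K]

omit [IsUltrametricDist K] in
/-- `σ(𝒪_K) ⊆ 𝒪_K` (`σ` is an isometry, `K/ℚ_p` algebraic). [cite: SerreLocalFields1979, Ch. II §2] -/
theorem norm_galois_le_one [Algebra.IsAlgebraic ℚ_[p] K] (σ : K ≃ₐ[ℚ_[p]] K) {x : K} (hx : ‖x‖ ≤ 1) :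
    ‖σ x‖ ≤ 1 := by rw [norm_algEquiv_eq]; exact hx

/-- The INERTIA CONDITION "`σ` moves `𝒪_K` within residue classes" is stable under composition:
`‖σ(τx) − x‖ ≤ max (‖σ(τx) − τx‖, ‖τx − x‖)`. [cite: SerreLocalFields1979, Ch. IV §1] -/
theorem norm_mul_galois_sub_lt_one [Algebra.IsAlgebraic ℚ_[p] K] {σ τ : K ≃ₐ[ℚ_[p]] K}
    (hσ : ∀ x : K, ‖x‖ ≤ 1 → ‖σ x - x‖ < 1) (hτ : ∀ x : K, ‖x‖ ≤ 1 → ‖τ x - x‖ < 1)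
    (x : K) (hx : ‖x‖ ≤ 1) : ‖(σ * τ) x - x‖ < 1 := by
  rw [AlgEquiv.mul_apply, show σ (τ x) - x = (σ (τ x) - τ x) + (τ x - x) by ring]
  refine lt_of_le_of_lt (IsUltrametricDist.norm_add_le_max _ _) (max_lt ?_ (hτ x hx))
  exact hσ (τ x) (norm_galois_le_one τ hx)

/-- … hence under powers. [cite: SerreLocalFields1979, Ch. IV §1] -/
theorem norm_pow_galois_sub_lt_one [Algebra.IsAlgebraic ℚ_[p] K] {σ : K ≃ₐ[ℚ_[p]] K}
    (hσ : ∀ x : K, ‖x‖ ≤ 1 → ‖σ x - x‖ < 1) (n : ℕ) (x : K) (hx : ‖x‖ ≤ 1) :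
    ‖(σ ^ n) x - x‖ < 1 := by
  induction n generalizing x with
  | zero => rw [pow_zero, AlgEquiv.one_apply, sub_self, norm_zero]; exact one_pos
  | succ n ih => rw [pow_succ]; exact norm_mul_galois_sub_lt_one ih hσ x hx

/-- … and every element of the cyclic group generated by such a `σ` (finite order) satisfies it.
[cite: SerreLocalFields1979, Ch. IV §1] -/
theorem norm_galois_sub_lt_one_of_mem_zpowers [Algebra.IsAlgebraic ℚ_[p] K] {σ : K ≃ₐ[ℚ_[p]] K}
    (hfin : IsOfFinOrder σ) (hσ : ∀ x : K, ‖x‖ ≤ 1 → ‖σ x - x‖ < 1) {τ : K ≃ₐ[ℚ_[p]] K}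
    (hτ : τ ∈ Subgroup.zpowers σ) (x : K) (hx : ‖x‖ ≤ 1) : ‖τ x - x‖ < 1 := by
  rw [← hfin.mem_powers_iff_mem_zpowers] at hτ
  obtain ⟨n, rfl⟩ := hτ
  exact norm_pow_galois_sub_lt_one hσ n x hx

omit [IsUltrametricDist K] in
/-- `σ̄ ū = τ̄ ū`-type congruences transport along an isometry: `‖σx − τx‖ < 1 ↔ ‖(τ⁻¹σ)x − x‖ < 1`.
[cite: SerreLocalFields1979, Ch. IV §1] -/
theorem norm_inv_mul_galois_sub_lt_one_iff [Algebra.IsAlgebraic ℚ_[p] K] (σ τ : K ≃ₐ[ℚ_[p]] K) (x : K) :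
    ‖(τ⁻¹ * σ) x - x‖ < 1 ↔ ‖σ x - τ x‖ < 1 := by
  have h : ‖(τ⁻¹ * σ) x - x‖ = ‖σ x - τ x‖ := by
    rw [← norm_algEquiv_eq τ ((τ⁻¹ * σ) x - x), map_sub, AlgEquiv.mul_apply, AlgEquiv.aut_inv,
      AlgEquiv.apply_symm_apply]
  rw [h]

omit [IsUltrametricDist K] in
/-- **`𝔪_K = p𝒪_K` for unramified `K`**: under `hK : ‖x‖ < 1 → ‖x‖ ≤ ‖p‖`, every `m` with `‖m‖ < 1` is
`p · x` with `‖x‖ ≤ 1`. [cite: SerreLocalFields1979, Ch. I §1] -/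
theorem exists_eq_prime_mul_of_norm_lt_one (hK : ∀ x : K, ‖x‖ < 1 → ‖x‖ ≤ ‖(p : K)‖) {m : K}
    (hm : ‖m‖ < 1) : ∃ x : K, ‖x‖ ≤ 1 ∧ m = p * x := by
  have hp0 : (p : K) ≠ 0 := norm_pos_iff.mp (norm_p_pos_lt (p := p) (K := K)).1
  refine ⟨m / p, ?_, by field_simp⟩
  rw [norm_div, div_le_one (norm_pos_iff.mpr hp0)]
  exact hK m hm

omit [IsUltrametricDist K] in
/-- `‖p‖ < 1` in `K`, hence `‖p‖ ^ n → 0`: for every `ε > 0` some `‖p‖ ^ n < ε`. [folklore] -/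
theorem exists_norm_prime_pow_lt {ε : ℝ} (hε : 0 < ε) : ∃ n : ℕ, ‖(p : K)‖ ^ n < ε :=
  exists_pow_lt_of_lt_one hε (norm_p_pos_lt (p := p) (K := K)).2

end Galois

end Summit.BirchSwinnertonDyer.BirchSwinnertonDyer.Theorems.KPort

end
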